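import Summits.BirchSwinnertonDyer.Rank1Residual.X11a.NormLamEndpoint
import Summits.BirchSwinnertonDyer.Rank1Residual.X11a.MuZero
import Literature.NumberTheory.EllipticCurves.CyclotomicPAdicLFunctionWeightK
import Literature.NumberTheory.EllipticCurves.HidaFamilyMembers
import Literature.NumberTheory.EllipticCurves.CaiShuTian2014.HeegnerConditionProofs
import HarnessLib

/-!
# Class X11a, surjective leaf: the socket for the published chain (Hida ∘ Wan ∘ Emerton–Pollack–Weston)
# — statement shapes of the three GL₂ inputs over an ABSTRACT algebraic interface, and the glue
# (cell `b2b-bsdres`, unit `b2b-bsdres-x11a`, gen 15)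

HONEST FRAMING (run/shared/lean/b2b/bsd-rank1-residual/, verbatim in every file): the goal of the
cell is to DELETE the COMBINATION-SHAPED residual classes of the Birch–Swinnerton-Dyer formula for
ALL analytic-rank `≤ 1` elliptic curves over `ℚ` — "full BSD formula for every rank `≤ 1` curve in
class `C`" assembled STRICTLY from published theorems — so that the rank-`≤ 1` remainder becomes
exactly the CONSTRUCTION-SHAPED classes, which are TYPED (missing-input `Prop`s), NOT attempted.
This is not "finishing BSD". Research route; NO CLAIM BEYOND STATED CLASSES. Three `Prop`-valued
definitions (STATEMENT SHAPES — typed inputs, nothing asserted, no named fact) and theorems.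

What this file is. The candidate chain HOME/b2b-bsdres-x11a/X11A-CHAIN.md (lit audit PASS as a
candidate, HOME/b2b-bsdres-lit/g14/X11A-AUDIT.md) reaches Mazur's main conjecture at a (ram)-free
multiplicative prime `p ≥ 5` with `ρ̄_{E,p}` surjective from:
[L1] a good-ordinary weight-`k` member `g` of the Hida family `H(E[p])` — TYPED, PUB:
`hida_exists_congruent_ordinary_newform_of_multiplicative` (p203345); [L3] the certificate
`X11a.MuAnZeroAt W p` (p203276); [L4] `μ^alg(E,p) = 0` from it and Kato A32 (`X11a/MuZero.lean`,
p203687); and three GL₂ statements not yet typed as Literature facts because the ALGEBRAIC side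
(Greenberg's Selmer group `Sel(ℚ_∞, A_g)` of the weight-`k` member and its `μ^alg`, `λ^alg`; EPW
§3.1, Thm. 3.1.1) has no tree vocabulary yet (HOME/b2b-bsdres-x11a/GL2-VOCAB-SPEC.md, item (V-alg),
owner harvest-2). The ANALYTIC side is typed (gen 15): `normLam` (EPW Def. 4.4.6; p203960) and
`IsCycPAdicLFunctionWeightK` + `exists_isCycPAdicLFunctionWeightK` (MTT §I.14; p204078).

This file writes the three statements OVER AN ABSTRACT ALGEBRAIC INTERFACE — two functions
`MuAlgZero g ι : Prop` ("`μ^alg(g) = 0`") and `lamAlg g ι : ℕ` ("`λ^alg(g)`") of a weight-`k`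
newform `g` on `Γ₀(N/p)` with a `p`-adic embedding `ι` of its coefficient field — as `Prop`-valued
SHAPES at the pair `(E, p)` (typed inputs, nothing asserted):

* `MuAlgTransferAt` = EPW Thm. 1 (algebraic), instance `f_E ↦ g`: `μ(X(E/ℚ_∞)) = 0` for every
  cyclotomic / dual datum ⇒ `MuAlgZero g ι` for every good-ordinary member `(g, ι)` of `H(E[p])`
  given by [L1]'s congruences;
* `WanLambdaAt` = X. Wan, Forum Math. Sigma 3 (2015) Thm. 4 (= Thm. 103), RATIONAL part, read as
  its `λ`-corollary at such a member (big residual image: `E[p]` surjective): `MuAlgZero g ι` ⇒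
  `λ^alg(g) = normLam L` for THE cyclotomic `p`-adic `L`-function `L` of `(g, ι)` (any period datum);
* `InvariantsTransferAt` = EPW Thm. 1 (analytic, `f_E ↦ g`) with Thm. 5.1.3 (source `g`, target
  `f_E`): `μ^alg(g) = 0`, `λ^alg(g) = λ^an(g)` and `μ^an(f_E) = 0` (the certificate; canonical vs
  Néron period = bridge N1 of the audit) ⇒ at every Kato pair `(gK, fE)` of `(E, p)`:
  unit contents and `normLam gK = normLam fE` (EPW's "`μ^alg = μ^an = 0`, `λ^alg = λ^an` at `f_E`"
  in the tree's normalisation, `X11a/NormLamEndpoint.lean`).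

GLUE (theorems): `invariantsAt_normLam_of_chain` — [L1] + the MTT existence fact + the three shapes +
Kato A32 + the certificate ⇒ `InvariantsAt W p (unit contents ∧ normLam gK = normLam fE)`; hence
`bsdp_of_chain` (`BSD(E,p)`, `r_an = 0`, surjective leaf) and the CLASS-LEVEL form
`forall_bsdp_of_chain`: on X11a ∩ {`p ≥ 5`, `ρ̄` surjective}, BSD(E,p) ⇐ PUB + the three shapes +
the per-pair certificate `MuAnZeroAt`. The day the Literature facts land (in whatever algebraic
vocabulary (V-alg) fixes), instantiate `MuAlgZero`, `lamAlg` and discharge the three shapes by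
adapters; nothing else changes. Auxiliary: `exists_unitRoot` (the unit root of
`X² − aX + c`, `|a| = 1`, `|c| < 1`, in `ℚ̄_p`), `neZero_conductorNorm_div`, `not_dvd_conductorNorm_div`.

What this does NOT do: it asserts none of the three statements (they are hypotheses, displayed);
no label change (X11a stays COMBINATION-SHAPED); the algebraic interface is abstract on purpose.

References: [EmertonPollackWeston2006] Thm. 1, Thm. 2, Thm. 3.1.1, Def. 4.4.6, Thm. 4.4.5, 4.4.7,
Thm. 5.1.2, Thm. 5.1.3, Cor. 5.1.4, Ex. 5.3.1; [Wan2015] Thm. 4 = Thm. 103 (pp. 4–5, 91–92);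
[MazurTateTeitelbaum1986] §I.14; [Hida1986]; HOME/b2b-bsdres-x11a/{X11A-CHAIN.md, GL2-VOCAB-SPEC.md §5},
HOME/b2b-bsdres-lit/g14/X11A-AUDIT.md.
-/

noncomputable section

open scoped Classical MatrixGroups ModularForm

open CongruenceSubgroup WeierstrassCurve Literature.NumberTheory.EllipticCurves
  Literature.NumberTheory.EllipticCurves.ModularForms
  Literature.NumberTheory.EllipticCurves.Rank1Residual
  Literature.NumberTheory.EllipticCurves.Rank1Residual.Typed
  Literature.NumberTheory.EllipticCurves.Wuthrich2014
  Literature.NumberTheory.EllipticCurves.SteinWuthrich2013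
  Literature.NumberTheory.EllipticCurves.GreenbergVatsal2000
  Summit.BirchSwinnertonDyer.Rank1Residual.X1.MuLambda
  Summit.BirchSwinnertonDyer.Rank1Residual.X11a.LambdaNorm

set_option autoImplicit false

namespace Summit.BirchSwinnertonDyer.Rank1Residual.X11a.Chain

/-! ### The abstract algebraic interface and the member predicate -/

/-- The type of an abstract "`μ^alg(g) = 0`" predicate on `p`-adically embedded newforms of level
`M` (to be instantiated by the Greenberg-Selmer vocabulary (V-alg): EPW §3.1 / Thm. 3.1.1,
"`Sel(ℚ_∞, A_g)[π]` is finite"). [cite: EmertonPollackWeston2006, §3.1 and Thm. 3.1.1 (shape only; nothing asserted)] -/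
abbrev MuAlgPred (p M : ℕ) [Fact p.Prime] : Type :=
  ∀ ⦃k : ℤ⦄ (g : CuspForm (Gamma0 M) k), (coeffField g →+* PadicAlgCl p) → Prop

/-- The type of an abstract "`λ^alg(g)`" on `p`-adically embedded newforms of level `M` (to be
instantiated by (V-alg): the number of zeroes of the characteristic power series of the dual of
`Sel(ℚ_∞, A_g)`, = `dim_k Sel(ℚ_∞, A_g)[π]` when `μ^alg(g) = 0`, EPW Thm. 3.1.1).
[cite: EmertonPollackWeston2006, §3.1 and Thm. 3.1.1 (shape only; nothing asserted)] -/
abbrev LamAlgFun (p M : ℕ) [Fact p.Prime] : Type :=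
  ∀ ⦃k : ℤ⦄ (g : CuspForm (Gamma0 M) k), (coeffField g →+* PadicAlgCl p) → ℕ

variable (W : WeierstrassCurve ℚ) [W.IsElliptic] [W.IsGloballyMinimal] (p : ℕ) [Fact p.Prime]

/-- **`IsMember W p g ι`: `(g, ι)` is a good-ordinary weight-`k` classical member of the Hida family
`H(E[p])` in the form produced by `hida_exists_congruent_ordinary_newform_of_multiplicative`**:
`g ∈ S_k(Γ₀(N/p))` a newform, `k > 2`, `k ≡ 2 (mod p − 1)`, `|ι(a_p(g))|_p = 1`, and
`|ι(a_ℓ(g)) − a_ℓ(E)|_p < 1` for every prime `ℓ ∤ N` (so `ρ̄_{g,ι} ≅ E[p]^{ss}`, `= E[p]` when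
irreducible). A predicate; nothing asserted. [cite: EmertonPollackWeston2006, Thm. 2.1.2, §2.1 and Ex. 5.3.1 (shape only)] -/
def IsMember [NeZero (W.conductorNorm ℤ / p)] {k : ℤ}
    (g : CuspForm (Gamma0 (W.conductorNorm ℤ / p)) k) (ι : coeffField g →+* PadicAlgCl p) : Prop :=
  2 < k ∧ ((p : ℤ) - 1) ∣ (k - 2) ∧ IsNewform0 g ∧
    ‖ι ⟨(UpperHalfPlane.qExpansion 1 ⇑g).coeff p, coeff_mem_coeffField g p⟩‖ = 1 ∧
    ∀ ℓ : ℕ, ℓ.Prime → ¬ ℓ ∣ W.conductorNorm ℤ →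
      ‖ι ⟨(UpperHalfPlane.qExpansion 1 ⇑g).coeff ℓ, coeff_mem_coeffField g ℓ⟩
          - ((W.frobeniusTrace ℓ : ℤ) : PadicAlgCl p)‖ < 1

/-! ### The three statement shapes at the pair `(E, p)` -/

/-- **Shape of EPW Thm. 1 (algebraic), instance `f_E ↦ g`** (Invent. Math. 163 (2006) Thm. 1 =
Thm. 3.7.?/4.3.3 algebraic form: "if `μ^alg(f₀) = 0` for some `f₀ ∈ H(ρ̄)` then `μ^alg(f) = 0` for
all `f ∈ H(ρ̄)`"; here `f₀ = f_E`, the `p`-new weight-two member, Ex. 5.3.1, and `f = g`): if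
`μ(X(E/ℚ_∞)) = 0` for every cyclotomic datum and every dual datum (the tree's intrinsic
`SelmerDualData.mu`; EPW's `μ^alg(f_E)` refers to Greenberg's Selmer group, which differs from the
classical one by the trivial-zero factor `T^e` of unit content — Skinner 2016 §3.2, Greenberg LNM
1716 §2), then `MuAlgZero g ι` for every member `(g, ι)`. Typed shape over the abstract interface;
nothing asserted. [cite: EmertonPollackWeston2006, Thm. 1 and Thm. 3.1.1 (shape only; nothing asserted)] -/
def MuAlgTransferAt [NeZero (W.conductorNorm ℤ / p)]
    (MuAlgZero : MuAlgPred p (W.conductorNorm ℤ / p)) : Prop :=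
  (∀ (κ : ZpExtension ℚ p) (γ : Field.absoluteGaloisGroup ℚ), κ.IsCyclotomic →
      κ.IsTopGenerator γ → IsCyclotomicVariable p γ →
      ∀ D : W.SelmerDualData κ γ, D.IsTorsion ∧ D.mu = 0) →
    ∀ {k : ℤ} (g : CuspForm (Gamma0 (W.conductorNorm ℤ / p)) k) (ι : coeffField g →+* PadicAlgCl p),
      IsMember W p g ι → MuAlgZero g ι

/-- **Shape of X. Wan, Forum Math. Sigma 3 (2015) e18, Thm. 4 (= Thm. 103), RATIONAL part, at a
good-ordinary member of `H(E[p])` with `E[p]` surjective, read as its `λ`-corollary**: "Suppose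
`p ≥ 5`. Let `f ∈ S_κ(M, L)`, `2 | κ ≥ 2`, be a `p`-ordinary cuspidal eigenform with trivial
character, `p ∤ M` … (irred) and (dist) … Then `char_{ℚ_∞,L}(f) = (L_f)` in `Λ_{ℚ,𝒪_L} ⊗ ℚ_p`"
⇒ (with `μ^alg = 0`, EPW Thm. 3.1.1) `λ^alg(f) = λ(L_f)` = `normLam L` for THE cyclotomic `p`-adic
`L`-function in any period normalisation (`IsCycPAdicLFunctionWeightK`; `normLam` is
scale-invariant), and `L` attains its maximal coefficient norm. Big image (the audit's T2′, flag
`Wan15-Thm103-Fujiwara`) is supplied here by `ρ̄_g ≅ E[p]` SURJECTIVE; (dist) by `k ≡ 2 (mod p−1)`.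
Typed shape over the abstract interface; nothing asserted.
[cite: Wan2015, Thm. 4 (pp. 4–5) = Thm. 103 (pp. 91–92) (shape only; nothing asserted)]
[cite: EmertonPollackWeston2006, Thm. 3.1.1 and Def. 4.4.6 (shape only)] -/
def WanLambdaAt [NeZero (W.conductorNorm ℤ / p)]
    (MuAlgZero : MuAlgPred p (W.conductorNorm ℤ / p))
    (lamAlg : LamAlgFun p (W.conductorNorm ℤ / p)) : Prop :=
  W.HasSurjectiveModNGaloisRep p →
    ∀ {k : ℤ} (g : CuspForm (Gamma0 (W.conductorNorm ℤ / p)) k) (ι : coeffField g →+* PadicAlgCl p),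
      IsMember W p g ι → MuAlgZero g ι →
      ∀ (υ : PadicAlgCl p) (D : PeriodSymbolDatum g) (L : PowerSeries (PadicAlgCl p)),
        υ ^ 2 - ι ⟨(UpperHalfPlane.qExpansion 1 ⇑g).coeff p, coeff_mem_coeffField g p⟩ * υ
            + (p : PadicAlgCl p) ^ (k - 1).toNat = 0 →
        ‖υ‖ = 1 → IsCycPAdicLFunctionWeightK g D p ι υ L →
        HasMaxCoeff L ∧ lamAlg g ι = normLam L

/-- **Shape of EPW Thm. 1 (analytic, `f_E ↦ g`) with Thm. 5.1.3 (source `f₀ = g`, target `f = f_E`)**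
(Invent. Math. 163 (2006): Thm. 1 "if `μ^an(f₀) = 0` for some `f₀ ∈ H(ρ̄)` then for all"; Thm.
5.1.3 "Suppose that `μ^alg(f₀) = μ^an(f₀) = 0` and `λ^alg(f₀) = λ^an(f₀)` for some `f₀` in the Hida
family … Then `μ^alg(f) = μ^an(f) = 0` and `λ^alg(f) = λ^an(f)` for every `f` in the Hida family";
`f_E ∈ H(E[p])` is the `p`-new weight-two point, Ex. 5.3.1): for a member `(g, ι)` with
`MuAlgZero g ι` and `lamAlg g ι = normLam L` (`L` THE cyclotomic `p`-adic `L`-function of `(g, ι)`,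
any period datum), and the certificate `μ^an(E,p) = 0` (`X11a.MuAnZeroAt W p`: Néron-normalised;
EPW's canonical period differs by a `p`-adic unit at `p ‖ N` under (irr) — Greenberg–Vatsal 2000
Prop. 3.1/3.3, Skinner 2016 §3.3, bridge N1 of the audit), the conclusion AT `f_E` in the tree's
normalisation: at every Kato pair `(gK, fE)` (`ι(T^e gK) = ϖ·L_p`, `char_Λ X = (fE)`; the prefix of
`X11a.InvariantsAt`) both have unit content and `normLam gK = normLam fE` (EPW's `λ^an(f_E) = λ(gK) + e`,
`λ^alg(f_E) = λ(fE) + e`, Greenberg vs classical Selmer: Skinner 2016 §3.2). Typed shape over the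
abstract interface; nothing asserted.
[cite: EmertonPollackWeston2006, Thm. 1, Thm. 5.1.3, Thm. 5.1.2 and Ex. 5.3.1 (shape only; nothing asserted)]
[cite: Skinner2016PacificMC, §3.2 and §3.3 (shape only)] -/
def InvariantsTransferAt [NeZero (W.conductorNorm ℤ / p)]
    (MuAlgZero : MuAlgPred p (W.conductorNorm ℤ / p))
    (lamAlg : LamAlgFun p (W.conductorNorm ℤ / p)) : Prop :=
  ∀ {k : ℤ} (g : CuspForm (Gamma0 (W.conductorNorm ℤ / p)) k) (ι : coeffField g →+* PadicAlgCl p),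
    IsMember W p g ι →
    ∀ (υ : PadicAlgCl p) (D : PeriodSymbolDatum g) (L : PowerSeries (PadicAlgCl p)),
      υ ^ 2 - ι ⟨(UpperHalfPlane.qExpansion 1 ⇑g).coeff p, coeff_mem_coeffField g p⟩ * υ
          + (p : PadicAlgCl p) ^ (k - 1).toNat = 0 →
      ‖υ‖ = 1 → IsCycPAdicLFunctionWeightK g D p ι υ L →
      MuAlgZero g ι → lamAlg g ι = normLam L →
      MuAnZeroAt W p →
      InvariantsAt W p fun gK fE => HasUnitContent gK ∧ HasUnitContent fE ∧ normLam gK = normLam fE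

/-! ### Auxiliary: the level `N/p` and the unit root -/

omit [W.IsElliptic] [W.IsGloballyMinimal] in
/-- At a multiplicative prime, `p ‖ N`: `N/p ≠ 0`. [folklore] -/
theorem neZero_conductorNorm_div [W.IsElliptic] [W.IsGloballyMinimal]
    (hmult : W.HasMultiplicativeReductionAtPrime p) : NeZero (W.conductorNorm ℤ / p) := by
  have hp : p.Prime := Fact.out
  have hN : W.conductorNorm ℤ ≠ 0 := (W.conductorNorm_pos_holds).ne'
  have hfac := W.factorization_conductorNorm_eq_one_of_hasMultiplicativeReductionAtPrime p hmult
  have hdvd : p ∣ W.conductorNorm ℤ := (hp.dvd_iff_one_le_factorization hN).mpr hfac.ge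
  refine ⟨fun h0 => ?_⟩
  rw [Nat.div_eq_zero_iff] at h0
  rcases h0 with h0 | h0
  · exact hp.ne_zero h0
  · exact absurd (Nat.le_of_dvd (Nat.pos_of_ne_zero hN) hdvd) (not_le.mpr h0)

omit [W.IsElliptic] [W.IsGloballyMinimal] in
/-- At a multiplicative prime, `p ‖ N`: `p ∤ N/p`. [folklore] -/
theorem not_dvd_conductorNorm_div [W.IsElliptic] [W.IsGloballyMinimal]
    (hmult : W.HasMultiplicativeReductionAtPrime p) : ¬ p ∣ W.conductorNorm ℤ / p := by
  have hp : p.Prime := Fact.out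
  have hN : W.conductorNorm ℤ ≠ 0 := (W.conductorNorm_pos_holds).ne'
  have hfac := W.factorization_conductorNorm_eq_one_of_hasMultiplicativeReductionAtPrime p hmult
  have hdvd : p ∣ W.conductorNorm ℤ := (hp.dvd_iff_one_le_factorization hN).mpr hfac.ge
  intro h
  have h2 : p ^ 2 ∣ W.conductorNorm ℤ := by
    rw [pow_two]
    exact Nat.mul_dvd_of_dvd_div hdvd h
  have := (hp.pow_dvd_iff_le_factorization hN).mp h2
  omega

omit [W.IsElliptic] [W.IsGloballyMinimal] in
/-- **The unit root in `ℚ̄_p`**: for `|a| = 1` and `|c| < 1` the polynomial `X² − aX + c` has a root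
of norm `1` in `ℚ̄_p` (algebraically closed; the two roots have product `c` and sum `a`, so by the
ultrametric inequality exactly one is a unit). Applied to `a = ι(a_p(g))`, `c = p^{k−1}`.
[folklore] -/
theorem exists_unitRoot {a c : PadicAlgCl p} (ha : ‖a‖ = 1) (hc : ‖c‖ < 1) :
    ∃ υ : PadicAlgCl p, υ ^ 2 - a * υ + c = 0 ∧ ‖υ‖ = 1 := by
  -- factor the monic quadratic over the algebraically closed field `ℚ̄_p`
  let q : Polynomial (PadicAlgCl p) := Polynomial.X ^ 2 - Polynomial.C a * Polynomial.X + Polynomial.C c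
  have hq : q = Polynomial.X ^ 2 + Polynomial.C (-a) * Polynomial.X + Polynomial.C c := by
    simp only [q, map_neg, neg_mul, sub_eq_add_neg]
  have hdeg : q.natDegree = 2 := by
    rw [hq]; compute_degree!
  have hne : q ≠ 0 := by
    intro h; rw [h] at hdeg; simp at hdeg
  -- roots `υ₁, υ₂` with `υ₁ + υ₂ = a`, `υ₁ υ₂ = c`
  obtain ⟨υ₁, hυ₁⟩ : ∃ x, q.IsRoot x :=
    IsAlgClosed.exists_root q (by rw [Polynomial.degree_eq_natDegree hne, hdeg]; norm_num)
  have heval : ∀ x : PadicAlgCl p, q.eval x = x ^ 2 - a * x + c := fun x => by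
    simp [q]
  have h1 : υ₁ ^ 2 - a * υ₁ + c = 0 := by rw [← heval]; exact hυ₁
  set υ₂ : PadicAlgCl p := a - υ₁ with hυ₂
  have h2 : υ₂ ^ 2 - a * υ₂ + c = 0 := by
    rw [hυ₂]; linear_combination h1
  have hprod : υ₁ * υ₂ = c := by rw [hυ₂]; linear_combination -h1
  have hsum : υ₁ + υ₂ = a := by rw [hυ₂]; ring
  -- ultrametric case analysis
  have hna := IsUltrametricDist.norm_add_le_max υ₁ υ₂
  rw [hsum, ha] at hna
  by_cases hυ₁1 : ‖υ₁‖ = 1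
  · exact ⟨υ₁, h1, hυ₁1⟩
  by_cases hυ₂1 : ‖υ₂‖ = 1
  · exact ⟨υ₂, h2, hυ₂1⟩
  exfalso
  have hnc : ‖υ₁‖ * ‖υ₂‖ < 1 := by rw [← norm_mul, hprod]; exact hc
  -- one of the norms is ≥ 1 (from the max), hence > 1; then the other is < 1 and the sum has norm > 1
  rcases le_max_iff.mp hna with h | h
  · have hgt : 1 < ‖υ₁‖ := lt_of_le_of_ne h (Ne.symm hυ₁1)
    have hlt : ‖υ₂‖ < 1 := by
      by_contra hge
      rw [not_lt] at hge
      have : 1 ≤ ‖υ₁‖ * ‖υ₂‖ := by nlinarith [norm_nonneg υ₂]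
      linarith
    have hne' : ‖υ₁‖ ≠ ‖υ₂‖ := by intro h'; linarith
    have := IsUltrametricDist.norm_add_eq_max_of_norm_ne_norm hne'
    rw [hsum, ha, max_eq_left (hlt.le.trans hgt.le)] at this
    linarith
  · have hgt : 1 < ‖υ₂‖ := lt_of_le_of_ne h (Ne.symm hυ₂1)
    have hlt : ‖υ₁‖ < 1 := by
      by_contra hge
      rw [not_lt] at hge
      have : 1 ≤ ‖υ₁‖ * ‖υ₂‖ := by nlinarith [norm_nonneg υ₁]
      linarith
    have hne' : ‖υ₁‖ ≠ ‖υ₂‖ := by intro h'; linarith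
    have := IsUltrametricDist.norm_add_eq_max_of_norm_ne_norm hne'
    rw [hsum, ha, max_eq_right (hlt.le.trans hgt.le)] at this
    linarith

/-! ### The glue -/

/-- **The chain at a pair, in the `normLam` currency.** From [L1] Hida's member (`hHida`, PUB
p203345), the Mazur–Tate–Teitelbaum existence fact (`hMTT`, PUB p204078), Shimura's period datum
(PROVED, `IsNewform0.nonempty_periodSymbolDatum`), the unit root (PROVED), the three GL₂ statement
shapes (`h1a`, `h2`, `h1b` — hypotheses, displayed above, over ANY algebraic interface
`MuAlgZero`/`lamAlg`), Kato A32 (`hKato`) with a modular parametrisation (`hpar`) for [L4]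
(`μ(X(E/ℚ_∞)) = 0` from the certificate), at a multiplicative `p ≥ 5` with `ρ̄_{E,p}` surjective and
the certificate `MuAnZeroAt W p`: every Kato pair `(gK, fE)` has unit contents and
`normLam gK = normLam fE`. [cite: EmertonPollackWeston2006, Thm. 1, Thm. 5.1.3, Ex. 5.3.1]
[cite: Wan2015, Thm. 4] -/
theorem invariantsAt_normLam_of_chain [NeZero (W.conductorNorm ℤ / p)]
    {MuAlgZero : MuAlgPred p (W.conductorNorm ℤ / p)} {lamAlg : LamAlgFun p (W.conductorNorm ℤ / p)}
    (hHida : hida_exists_congruent_ordinary_newform_of_multiplicative)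
    (hMTT : exists_isCycPAdicLFunctionWeightK)
    (hKato : kato_charIdeal_dvd_multiplicative_of_surjective)
    (hpar : nonempty_modularParametrizationData)
    (h1a : MuAlgTransferAt W p MuAlgZero) (h2 : WanLambdaAt W p MuAlgZero lamAlg)
    (h1b : InvariantsTransferAt W p MuAlgZero lamAlg)
    (hp : 5 ≤ p) (hmult : W.HasMultiplicativeReductionAtPrime p)
    (hsurj : W.HasSurjectiveModNGaloisRep p) (hμ : MuAnZeroAt W p) :
    InvariantsAt W p fun gK fE => HasUnitContent gK ∧ HasUnitContent fE ∧ normLam gK = normLam fE := by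
  have hprime : p.Prime := Fact.out
  have hp2 : p ≠ 2 := by omega
  -- [L1]: the weight-`k` member, `k = (p − 1) + 2`
  set n : ℕ := p - 1 with hn
  have hn0 : n ≠ 0 := by omega
  have hneven : Even n := hn ▸ hprime.even_sub_one hp2
  have hk2 : (2 : ℤ) < (n : ℤ) + 2 := by omega
  have hkdvd : ((p : ℤ) - 1) ∣ ((n : ℤ) + 2 - 2) := by
    refine ⟨1, ?_⟩
    rw [hn, Nat.cast_sub hprime.one_le]; push_cast; ring
  obtain ⟨g, ι, hg, hap, hcong⟩ := hHida W p hp hmult inferInstance ((n : ℤ) + 2) hk2 hkdvd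
  have hmem : IsMember W p g ι := ⟨hk2, hkdvd, hg, hap, hcong⟩
  -- Shimura's period datum and the unit root
  obtain ⟨D⟩ := IsNewform0.nonempty_periodSymbolDatum hneven hn0 hg
  have hc : ‖(p : PadicAlgCl p) ^ ((n : ℤ) + 2 - 1).toNat‖ < 1 := by
    rw [norm_pow, show ((n : ℤ) + 2 - 1).toNat = n + 1 by omega]
    have hpn : ‖(p : PadicAlgCl p)‖ < 1 := by
      rw [← map_natCast (algebraMap ℚ_[p] (PadicAlgCl p)), norm_algebraMap', Padic.norm_p]
      exact inv_lt_one_of_one_lt₀ (by exact_mod_cast hprime.one_lt)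
    exact pow_lt_one₀ (norm_nonneg _) hpn (by omega)
  obtain ⟨υ, hroot, hunit⟩ := exists_unitRoot p hap hc
  -- THE cyclotomic `p`-adic `L`-function of `(g, ι)`
  obtain ⟨L, hL, -, -⟩ := hMTT g hg (by omega) p (not_dvd_conductorNorm_div W p hmult) ι υ hroot
    hunit D
  -- [L4]: `μ(X(E/ℚ_∞)) = 0` for every cyclotomic / dual datum, from the certificate
  have hμalg : ∀ (κ : ZpExtension ℚ p) (γ : Field.absoluteGaloisGroup ℚ), κ.IsCyclotomic →
      κ.IsTopGenerator γ → IsCyclotomicVariable p γ →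
      ∀ D' : W.SelmerDualData κ γ, D'.IsTorsion ∧ D'.mu = 0 :=
    fun κ γ hκ hγ hγ' D' =>
      ⟨(isTorsion_and_exists_generator_hasUnitContent_of_muAnZeroAt W p hKato hpar hp hmult hsurj hμ
          hκ hγ hγ' D').1,
        selmerDual_mu_eq_zero_of_muAnZeroAt W p hKato hpar hp hmult hsurj hμ hκ hγ hγ' D'⟩
  -- EPW Thm. 1 (alg): `μ^alg(g) = 0`; Wan: `λ^alg(g) = λ^an(g)`; EPW Thm. 1 (an) + Thm. 5.1.3
  have hMu : MuAlgZero g ι := h1a hμalg g ι hmem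
  have hlam : lamAlg g ι = normLam L := (h2 hsurj g ι hmem hMu υ D L hroot hunit hL).2
  exact h1b g ι hmem υ D L hroot hunit hL hMu hlam hμ

/-- **`BSD(E,p)` at a pair of X11a's surjective leaf from the chain** (`r_an = 0`): the
`normLam` socket `bsdp_of_invariantsAt_normLam` (Kato A32, Stein–Wuthrich Thm. 6.1, heights,
Greenberg–Stevens, GZK, modularity). [cite: EmertonPollackWeston2006, Thm. 5.1.2 and Thm. 5.1.3]
[cite: Wan2015, Thm. 4] [cite: SteinWuthrich2013, Thm. 6.1 (p. 20)] -/
theorem bsdp_of_chain [NeZero (W.conductorNorm ℤ / p)]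
    {MuAlgZero : MuAlgPred p (W.conductorNorm ℤ / p)} {lamAlg : LamAlgFun p (W.conductorNorm ℤ / p)}
    (hHida : hida_exists_congruent_ordinary_newform_of_multiplicative)
    (hMTT : exists_isCycPAdicLFunctionWeightK)
    (hKato : kato_charIdeal_dvd_multiplicative_of_surjective)
    (hJs : thm61_splitMultiplicative) (hJn : thm61_nonsplitMultiplicative)
    (hHs : exists_isSplitMultCanonical) (hHn : exists_isMultCanonical)
    (hGZK : rank_eq_analyticRank_of_analyticRank_le_one) (hmod : hasEntireLFunction_rat)
    (hpar : nonempty_modularParametrizationData)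
    (hGS : greenberg_stevens (W := W) (p := p))
    (h1a : MuAlgTransferAt W p MuAlgZero) (h2 : WanLambdaAt W p MuAlgZero lamAlg)
    (h1b : InvariantsTransferAt W p MuAlgZero lamAlg)
    (hp : 5 ≤ p) (hmult : W.HasMultiplicativeReductionAtPrime p)
    (hsurj : W.HasSurjectiveModNGaloisRep p) (hr : W.analyticRank = 0) (hμ : MuAnZeroAt W p) :
    BSDp W p :=
  bsdp_of_invariantsAt_normLam W p hKato hJs hJn hHs hHn hGZK hmod hpar hGS hp hmult hsurj hr
    (invariantsAt_normLam_of_chain W p hHida hMTT hKato hpar h1a h2 h1b hp hmult hsurj hμ)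

end Summit.BirchSwinnertonDyer.Rank1Residual.X11a.Chain

/-! ### Class-level form: X11a ∩ {p ≥ 5, ρ̄ surjective} = PUB + the three shapes + the certificate -/

namespace Summit.BirchSwinnertonDyer.Rank1Residual.X11a

open Chain

/-- **X11a, `p ≥ 5`, surjective image, CLASS LEVEL, through the chain**: if at every pair of the
class the three GL₂ statement shapes hold for SOME algebraic interface (as they will, uniformly,
once EPW Thm. 1 / Thm. 5.1.3 and Wan Thm. 4 are typed against the Greenberg-Selmer vocabulary),
then `BSD(E,p)` holds at every pair carrying the certificate `μ^an(E,p) = 0` — X11a(surj) =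
PUB([L1] Hida, MTT, A32, SW13, GS93, GZK, modularity; EPW06 Thm 1/5.1.3; Wan15 Thm 4) + per-pair
certificate; class-level residue = Greenberg's `μ`-conjecture (OPEN, NAMED). No label change.
[cite: EmertonPollackWeston2006, Thm. 1, Thm. 5.1.3, Cor. 5.1.4] [cite: Wan2015, Thm. 4]
[cite: SteinWuthrich2013, Thm. 6.1 (p. 20)] -/
theorem forall_bsdp_of_chain
    (hHida : hida_exists_congruent_ordinary_newform_of_multiplicative)
    (hMTT : exists_isCycPAdicLFunctionWeightK)
    (hKato : kato_charIdeal_dvd_multiplicative_of_surjective)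
    (hJs : thm61_splitMultiplicative) (hJn : thm61_nonsplitMultiplicative)
    (hHs : exists_isSplitMultCanonical) (hHn : exists_isMultCanonical)
    (hGZK : rank_eq_analyticRank_of_analyticRank_le_one) (hmod : hasEntireLFunction_rat)
    (hpar : nonempty_modularParametrizationData)
    (hGS : ∀ (W : WeierstrassCurve ℚ) [W.IsElliptic] [W.IsGloballyMinimal] (p : ℕ) [Fact p.Prime],
      greenberg_stevens (W := W) (p := p))
    (hchain : ∀ (W : WeierstrassCurve ℚ) [W.IsElliptic] [W.IsGloballyMinimal] (p : ℕ) [Fact p.Prime]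
      [NeZero (W.conductorNorm ℤ / p)], ClassX11a W p → 5 ≤ p → Surj W p →
      ∃ (MuAlgZero : MuAlgPred p (W.conductorNorm ℤ / p))
        (lamAlg : LamAlgFun p (W.conductorNorm ℤ / p)),
        MuAlgTransferAt W p MuAlgZero ∧ WanLambdaAt W p MuAlgZero lamAlg ∧
          InvariantsTransferAt W p MuAlgZero lamAlg) :
    ∀ (W : WeierstrassCurve ℚ) [W.IsElliptic] [W.IsGloballyMinimal] (p : ℕ) [Fact p.Prime],
      ClassX11a W p → 5 ≤ p → Surj W p → MuAnZeroAt W p → BSDp W p := by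
  intro W _ _ p _ hX hp hsurj hμ
  haveI : NeZero (W.conductorNorm ℤ / p) := neZero_conductorNorm_div W p hX.2.2.1
  obtain ⟨MuAlgZero, lamAlg, h1a, h2, h1b⟩ := hchain W p hX hp hsurj
  exact bsdp_of_chain W p hHida hMTT hKato hJs hJn hHs hHn hGZK hmod hpar (hGS W p) h1a h2 h1b hp
    hX.2.2.1 hsurj hX.1 hμ

end Summit.BirchSwinnertonDyer.Rank1Residual.X11a

end
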